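import Mathlib
import Literature.MathematicalPhysics.QuantumFieldTheory.Balaban1983to89.T3YM3TorusStatement
import Literature.MathematicalPhysics.QuantumFieldTheory.Balaban1983to89.T3NestedUnitLaws
import Literature.MathematicalPhysics.QuantumFieldTheory.Balaban1983to89.T3UnitLawDensityEML
import Literature.MathematicalPhysics.QuantumFieldTheory.Balaban1983to89.BalabanUVClass
import Literature.MathematicalPhysics.QuantumFieldTheory.Balaban1983to89.T3UnitScaleTilt

/-!
# Route `BackwardLiouvilleRigidity`, support `FlatRatioTermination` (stmt-QuantumFields-22542) — registered stub `stub_pushToZero`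

The measure-theoretic end of the planner's skeleton `Cruxes/FluctuationComparisonRegPrIntL/Lines/flat_ratio_termination.lean`
(ym-r3-idea-1 g10, sha 45959ca5): two CONSISTENT trajectories of probability laws `μ_j = (descend j)_* μ_{j+1}`,
`μ'_j = (descend j)_* μ'_{j+1}` whose height-`j` laws are `ε`-close in total variation at SOME height for EVERY `ε > 0` have the
same height-`0` law, hence the same height-`0` loop integrals.

Proof.  By induction on `j`, every measurable `A` at height `0` has a measurable pull-back `B` at height `j` with
`μ_0 A = μ_j B` and `μ'_0 A = μ'_j B` (`Measure.map_apply` with `T3NestedUnitLaws.measurable_descend`); so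
`|μ_0 A − μ'_0 A| ≤ ε` for every `ε`, i.e. `μ_0 = μ'_0`.

HONEST SCOPE.  One of three registered stubs of a SUPPORT item; the geometric stub `stub_innerWindowChains` and the crux
`ClassLimitTrajectories` stay open; no rung (R3 is a RECORD rung), no summit statement and nothing about the Yang–Mills mass gap is
proved here.
-/

namespace Summit.QuantumFields.YangMills.Theorems.FlatRatioTermination

open MeasureTheory Filter Topology
open Literature.MathematicalPhysics.QuantumFieldTheory.Balaban1983to89
open Literature.MathematicalPhysics.QuantumFieldTheory.Balaban1983to89.T3ContinuumYM3Torus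
open Literature.MathematicalPhysics.QuantumFieldTheory.Balaban1983to89.T3NestedUnitLaws
open Literature.MathematicalPhysics.QuantumFieldTheory.Balaban1983to89.T3UnitLawDensityEML

/-- PULL-BACK ALONG A CONSISTENT TRAJECTORY: for two consistent trajectories and every measurable height-`0` event `A` there is a
measurable height-`j` event `B` (the iterated `descend`-preimage) with `μ_0 A = μ_j B` and `μ'_0 A = μ'_j B`. [folklore] -/
theorem exists_pullback_of_consistent (F : T3Family)
    (μ μ' : (j : ℕ) → Measure (GaugeField (F.P j) 0 ↥(Matrix.specialUnitaryGroup (Fin 2) ℂ)))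
    (hμ : ∀ j : ℕ, μ j = Measure.map (descend F ℰp j) (μ (j + 1)))
    (hμ' : ∀ j : ℕ, μ' j = Measure.map (descend F ℰp j) (μ' (j + 1))) :
    ∀ (j : ℕ) (A : Set (GaugeField (F.P 0) 0 ↥(Matrix.specialUnitaryGroup (Fin 2) ℂ))), MeasurableSet A →
      ∃ B : Set (GaugeField (F.P j) 0 ↥(Matrix.specialUnitaryGroup (Fin 2) ℂ)), MeasurableSet B ∧ μ 0 A = μ j B ∧ μ' 0 A = μ' j B := by
  intro j
  induction j with
  | zero => exact fun A hA => ⟨A, hA, rfl, rfl⟩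
  | succ j ih =>
    intro A hA
    obtain ⟨B, hB, h1, h2⟩ := ih A hA
    have hmeas := measurable_descend F ℰp (G := ↥(Matrix.specialUnitaryGroup (Fin 2) ℂ)) measurableE_ℰp j
    refine ⟨descend F ℰp j ⁻¹' B, hmeas hB, ?_, ?_⟩
    · rw [h1, hμ j, Measure.map_apply hmeas hB]
    · rw [h2, hμ' j, Measure.map_apply hmeas hB]

/-- EQUAL HEIGHT-`0` LAWS: two consistent trajectories of probability laws that are `ε`-close in total variation at some height for
every `ε > 0` have the same height-`0` law. [folklore] -/
theorem measure_zero_eq_of_consistent (F : T3Family)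
    (μ μ' : (j : ℕ) → Measure (GaugeField (F.P j) 0 ↥(Matrix.specialUnitaryGroup (Fin 2) ℂ)))
    (hμ : ∀ j : ℕ, IsProbabilityMeasure (μ j) ∧ μ j = Measure.map (descend F ℰp j) (μ (j + 1)))
    (hμ' : ∀ j : ℕ, IsProbabilityMeasure (μ' j) ∧ μ' j = Measure.map (descend F ℰp j) (μ' (j + 1)))
    (hTV : ∀ ε : ℝ, 0 < ε → ∃ j : ℕ, ∀ A : Set (GaugeField (F.P j) 0 ↥(Matrix.specialUnitaryGroup (Fin 2) ℂ)),
      MeasurableSet A → |(μ j).real A - (μ' j).real A| ≤ ε) :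
    μ 0 = μ' 0 := by
  haveI : IsProbabilityMeasure (μ 0) := (hμ 0).1
  haveI : IsProbabilityMeasure (μ' 0) := (hμ' 0).1
  refine Measure.ext fun A hA => ?_
  have hreal : (μ 0).real A = (μ' 0).real A := by
    have habs : |(μ 0).real A - (μ' 0).real A| ≤ 0 := by
      refine le_of_forall_pos_le_add fun ε hε => ?_
      obtain ⟨j, hj⟩ := hTV ε hε
      obtain ⟨B, hB, h1, h2⟩ := exists_pullback_of_consistent F μ μ' (fun j => (hμ j).2) (fun j => (hμ' j).2) j A hA
      have := hj B hB
      rw [measureReal_def, measureReal_def, h1, h2, ← measureReal_def, ← measureReal_def]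
      linarith
    have h0 : |(μ 0).real A - (μ' 0).real A| = 0 := le_antisymm habs (abs_nonneg _)
    exact sub_eq_zero.mp (abs_eq_zero.mp h0)
  rw [measureReal_def, measureReal_def] at hreal
  exact (ENNReal.toReal_eq_toReal_iff' (measure_ne_top _ _) (measure_ne_top _ _)).mp hreal

/-- **REGISTERED STUB `stub_pushToZero`** of the skeleton for `FlatRatioTermination` (stmt-QuantumFields-22542), verbatim: two
consistent trajectories `ε`-close in total variation at some height for every `ε` have equal height-`0` loop integrals (they have the
same height-`0` law, `measure_zero_eq_of_consistent`). [folklore] -/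
theorem stub_pushToZero : open MeasureTheory Filter Topology Literature.MathematicalPhysics.QuantumFieldTheory.Balaban1983to89 T3ContinuumYM3Torus T3NestedUnitLaws T3UnitLawDensityEML T4Continuum BalabanUVClass T3UnitScaleTilt in ∀ (F : T3Family) (μ μ' : ((j : ℕ) → MeasureTheory.Measure (GaugeField (F.P j) 0 ↥(Matrix.specialUnitaryGroup (Fin 2) ℂ)))), (∀ j : ℕ, IsProbabilityMeasure (μ j) ∧ μ j = Measure.map (descend F ℰp j) (μ (j + 1))) → (∀ j : ℕ, IsProbabilityMeasure (μ' j) ∧ μ' j = Measure.map (descend F ℰp j) (μ' (j + 1))) → (∀ ε : ℝ, 0 < ε → ∃ j : ℕ, ∀ A : Set (GaugeField (F.P j) 0 ↥(Matrix.specialUnitaryGroup (Fin 2) ℂ)), MeasurableSet A → |(μ j).real A - (μ' j).real A| ≤ ε) → ∀ os : List (ULoop3 F), (∫ u, (os.map fun C => loopAt u (C.1.atLevel 0)).prod ∂(μ 0)) = (∫ u, (os.map fun C => loopAt u (C.1.atLevel 0)).prod ∂(μ' 0)) := by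
  intro F μ μ' hμ hμ' hTV os
  rw [measure_zero_eq_of_consistent F μ μ' hμ hμ' hTV]

end Summit.QuantumFields.YangMills.Theorems.FlatRatioTermination
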